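import Summits.BirchSwinnertonDyer.BirchSwinnertonDyer.Theorems.RamifiedSevenEllipticUnitsPinnedCharacterRigidity
import Summits.BirchSwinnertonDyer.BirchSwinnertonDyer.Theorems.RamifiedSevenEllipticUnitsRigidityFromPairs
import Summits.BirchSwinnertonDyer.Rank1Residual.X12.CMSevenAwayFromSeven
import HarnessLib

set_option linter.dupNamespace false
set_option autoImplicit false

/-!
# H_Rig⁰ CLOSED: the registered stub `stub_pinnedCharacterRigiditySeven` of the K7r Value crux

Closing file for the registered stub H_Rig⁰ of line `rubin-formula-zp` v4.2 (`bd085e9ecccbb7e3`) of the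
crux `EllipticUnitValueSevenOfGZK` (stmt-BirchSwinnertonDyer-19945):
`stub_pinnedCharacterRigiditySeven : ∀ W ∈ 𝒞₇, X12.O11.RamifiedCMPinnedCharacterRigidityAtZp W 7` —
every Hecke character `L`-pinned to a curve of the class is the Deuring-type character `ψ` or its
conjugate `ψ ∘ c`. It is the composition (planner D169/D171/D172) of

* the ANALYTIC END (seat k7r-c2 g7): (R1) `Rigidity.exists_heckeLFunction_eq_LSeries_translate`,
  (R2a) `Rigidity.weightedCoeff_eq_of_heckeLFunction_eq`, (R2b) `Rigidity.valuePair_eq_of_heckeLFunction_eq`;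
* the COMPOSITION (line owner k7r-c4 g10, p514434): (G1) `Rigidity.value_eq_of_heckeLFunction_eq_of_inert`,
  (G2) `Rigidity.valuePairs_eventually_of_heckeLFunction_eq`, (G3 mod VPR)
  `PinnedRigidity.pinnedCharacterRigidityAtZp_of_valuePairsRigidity`;
* the ALGEBRAIC END (seat k7r-c3 g12): `Rigidity.eq_or_eq_galConj_of_valuePairs` (archimedean
  parameters via Neukirch's Größencharakter relation S5, `π/cπ` not a root of unity, GL(1) rigidity).

Also recorded: the general statement at every prime `p` (`pinnedCharacterRigidityAtZp`) and the
field-theoretic corollary it rests on (`Rigidity.eq_or_eq_galConj_of_heckeLFunction_eq`: two Hecke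
characters of an imaginary quadratic field with the same `L`-function on a right half-plane, one of
them of infinity type `(1,0)`, are equal or conjugate). HONEST FRAMING: kernel theorems only; this
closes ONE registered stub of the line (4 → 3: S_pkg⁻, H_Facts, S_arch remain — PRE / print / research);
nothing about BSD is claimed.

References: Neukirch, *Algebraic Number Theory*, VII §6 (6.13)–(6.14), §8 (8.1); Ribet, LNM 601 §3;
Silverman, *Advanced Topics*, II Thm. 10.5.
-/

noncomputable section

open scoped Classical Pointwise
open Filter NumberField IsDedekindDomain
  Literature.NumberTheory.GaloisRepresentations
  Literature.NumberTheory.EllipticCurves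
  Summit.BirchSwinnertonDyer.Rank1Residual

namespace Summit.BirchSwinnertonDyer.BirchSwinnertonDyer.Theorems.RamifiedSevenEllipticUnits

/-- **Rigidity of `L`-pinning in an imaginary quadratic field.** `K` imaginary quadratic with
non-trivial automorphism `c`; `ψ` a Hecke character of infinity type `(1, 0)`; `φ` ANY Hecke character
with `heckeLFunction φ s = heckeLFunction ψ s` for `re s > s₀`. Then `φ = ψ` or `φ = ψ ∘ c`.
(Composition of (G2) `Rigidity.valuePairs_eventually_of_heckeLFunction_eq` with the algebraic end
`Rigidity.eq_or_eq_galConj_of_valuePairs`.) [cite: NeukirchANT1999, Ch. VII §6 Prop. (6.13) and §8 (8.1)]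
[cite: Ribet1977Nebentypus, §3 Thm. (3.4)] -/
theorem Rigidity.eq_or_eq_galConj_of_heckeLFunction_eq {K : Type} [Field K] [NumberField K]
    (hK : IsImaginaryQuadratic K) (c : K ≃ₐ[ℚ] K) (hc : c ≠ 1) {φ ψ : HeckeCharacter K}
    (hinf : ψ.HasInfinityType (fun _ ↦ 1) (fun _ ↦ 0)) (s₀ : ℝ)
    (h : ∀ s : ℂ, s₀ < s.re → heckeLFunction φ s = heckeLFunction ψ s) :
    φ = ψ ∨ φ = HeckeCharacter.galConj c ψ :=
  Rigidity.eq_or_eq_galConj_of_valuePairs hK c hc hinf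
    (Rigidity.valuePairs_eventually_of_heckeLFunction_eq hK.1 c hc φ ψ s₀ h)

/-- **H_Rig⁰ at every prime**: the typed input `X12.O11.RamifiedCMPinnedCharacterRigidityAtZp W p`
(pure rigidity of the pinned characters at every O11 frame) HOLDS for every `W` and `p`.
[cite: SilvermanATAEC1994, Ch. II Thm. 10.5 (the character pinned by `L(E/ℚ, s) = L(ψ, s)`; shape only)]
[cite: NeukirchANT1999, Ch. VII §8 (8.1)] -/
theorem pinnedCharacterRigidityAtZp (W : WeierstrassCurve ℚ) [W.IsElliptic] [W.IsGloballyMinimal]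
    (p : ℕ) [Fact p.Prime] : X12.O11.RamifiedCMPinnedCharacterRigidityAtZp W p :=
  PinnedRigidity.pinnedCharacterRigidityAtZp_of_valuePairsRigidity
    (fun _ _ _ hK c hc _ _ hinf hpair ↦ Rigidity.eq_or_eq_galConj_of_valuePairs hK c hc hinf hpair) W p

/-- **H_Rig⁰ — the registered stub `stub_pinnedCharacterRigiditySeven` of line `rubin-formula-zp`
v4.2 (crux stmt-BirchSwinnertonDyer-19945), BY NAME and VERBATIM**: for every globally minimal
`W ∈ 𝒞₇`, `X12.O11.RamifiedCMPinnedCharacterRigidityAtZp W 7`. (The class hypothesis is not even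
needed: `pinnedCharacterRigidityAtZp W 7`.) [cite: SilvermanATAEC1994, Ch. II Thm. 10.5 (shape only)]
[cite: NeukirchANT1999, Ch. VII §6 Prop. (6.13), §8 (8.1)] -/
theorem stub_pinnedCharacterRigiditySeven : ∀ (W : WeierstrassCurve ℚ) [W.IsElliptic] [W.IsGloballyMinimal] [Fact (Nat.Prime 7)], X12.ClassCSeven W → X12.O11.RamifiedCMPinnedCharacterRigidityAtZp W 7 :=
  fun W _ _ _ _ ↦ pinnedCharacterRigidityAtZp W 7

end Summit.BirchSwinnertonDyer.BirchSwinnertonDyer.Theorems.RamifiedSevenEllipticUnits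

end
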